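import Literature.Geometry.Kaehler.ComplexTorusLefschetzGroupPower
import HarnessLib

/-!
# Milne's centraliser `C(A)` is stable under the Rosati involution, independently of the
# polarisation, compatibly with products and powers (Milne 1999, §1, pp. 642–643)

Layer `Literature/Geometry/Kaehler`, namespace `Literature.Geometry.Kaehler.ComplexTorus`; lane
`lit-hodgefound` (Track 2 foundations library), Layer A4, self-proposed row A4-21⁺⁺⁺⁺⁺⁺ · Q155⁺⁺ of
`run/shared/lean/pub/lit-hodgefound/SKELETON.md`; sequel of `ComplexTorusLefschetzGroupProduct.lean`
(`endCentralizerAlg Φ` = Milne's `C(A)` for `k = ℝ`, `blockDiagAlg`, `diagPow`), `ComplexTorusLefschetzGroupPower.lean`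
(`latticeGram_pow_eq_diagPow`, `transpose_diagPow`, `det_diagPow`) and `ComplexTorusRosati.lean` (the Rosati
involution `rosati G A = G⁻¹ ᵗA G` in the rational representation, `rosati_mem_endAlgRat`, `rosati_mul`,
`rosati_rosati`, `rosati_eq_iff`, `mul_rosati`, `rosati_map`). CONCRETE torus level, model-free:
`X = E/Φ(ℤ^ι)`, a polarisation is a Riemann form `η` (`IsRiemannForm Φ η`) with real Gram matrix
`G = latticeGram Φ η` on the lattice basis, and the involution "defined by the ample divisor" is
`M ↦ M† = G⁻¹ ᵗM G` on `End_ℝ(V_ℝ) = M_ι(ℝ)` (the adjoint for `E = ᵗx G y`, Prop. 2.4.2 (a)).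

Source followed, verbatim: J. S. Milne, *Lefschetz classes on abelian varieties*, Duke Math. J. 96
(1999), §1, pp. 642–643 (held `paper:doi-10-1215-s0012-7094-99-09620-5`, p0004 L70 – p0005 L20): "we
define `C(A)` to be the centralizer of `End⁰(A)` in `End_k(V(A))` […] Then `C(A)` is a `k`-algebra stable
under the involution `†` defined by an ample divisor `D`, and the restriction of `†` to `C(A)` is
independent of the choice of `D`. […] For any positive integer `r`, `V(A^r) = rV(A)`, and the diagonal
action of `C(A)` on `rV(A)` identifies `C(A)` with `C(A^r)` (as `k`-algebras with involution). Let
`A = A₁ × ⋯ × A_s`. Then `C(A) ⊂ C(A₁) × ⋯ × C(A_s)` […]. Moreover, if `D_i` is an ample divisor on `A_i`,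
`i = 1, …, s`, then `D = Σ_i A₁ × ⋯ × A_{i-1} × D_i × A_{i+1} × ⋯ × A_s` is an ample divisor on `A`, and
the involution it defines on `C(A)` is the restriction of the product of the involutions on the `C(A_i)`
defined by the `D_i`."

Proofs. Stability: `End_ℚ(X)` is `†`-stable (Lemma 2.4.1, `rosati_mem_endAlgRat`) and `†` is an
anti-involution, so `Mφ = φM` for all `φ ∈ End_ℚ(X)` gives `φ† M† = M† φ†`, and `φ†` exhausts `End_ℚ(X)`
(`φ = (φ†)†`). Independence: for a second polarisation (indeed any non-degenerate `E₁ ∈ NS_ℚ(X)`),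
`G₁ = G₀ φ` with `φ = φ_{E₀}⁻¹ φ_{E₁} ∈ End_ℚ(X)` (Prop. 2.4.12, the tree's `nsToEnd`); for `M ∈ C(A)`,
`M†₀ ∈ C(A)` commutes with `φ`, whence `ᵗM G₁ = ᵗM G₀ φ = G₀ M†₀ φ = G₀ φ M†₀ = G₁ M†₀`, i.e. `M†₁ = M†₀`.
Products / powers: the Gram matrix of the product (power) polarisation is block diagonal, `(G₁ 0; 0 G₂)`
(`1ₙ ⊗ G`), and `ᵗ(A 0; 0 D)(G₁ 0; 0 G₂) = (G₁ 0; 0 G₂)(A†₁ 0; 0 D†₂)`, `ᵗ(1 ⊗ A)(1 ⊗ G) = (1 ⊗ G)(1 ⊗ A†)`.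

## Contents (PROVED theorems only; no definition, no named fact, net debt 0)

* §1 `map_ratCast_rosati` (realification of `†` on `End_ℚ(X)`), **`IsRiemannForm.rosati_mem_endCentralizerAlg`**
  ("`C(A)` is stable under the involution `†` defined by an ample divisor"), `IsRiemannForm.rosati_rosati_latticeGram`
  (`†` is an involution), `IsRiemannForm.rosati_mul_latticeGram` (anti-multiplicative).
* §2 **`IsRiemannForm.rosati_eq_of_mem_neronSeveriQ`** (for `M ∈ C(A)`, `M†_{E₁} = M†_{E₀}` for every
  non-degenerate `E₁ ∈ NS_ℚ(X)`), **`IsRiemannForm.rosati_eq_of_mem_endCentralizerAlg`** ("the restriction of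
  `†` to `C(A)` is independent of the choice of `D`").
* §3 `isUnit_det_latticeGram_prod`, **`rosati_latticeGram_prod_blockDiagAlg`** ("the involution it defines on
  `C(A)` is the restriction of the product of the involutions").
* §4 `isUnit_det_latticeGram_pow`, **`rosati_latticeGram_pow_diagPow`** ("identifies `C(A)` with `C(A^r)` as
  `k`-algebras with involution").

## Addendum (p13 gen 6, rides under this file's row): the involution of a second divisor

* `rosati_mul_right_eq_conj` (`†_{Gα} β = α⁻¹ (†_G β) α`) and `IsRiemannForm.rosati_latticeGram_eq_conj_nsToEnd` —
  Milne §1 p. 642: "If `D′` is a second divisor on `A`, then `e_{D′} = e_D ∘ (α × 1)` for some `α ∈ End⁰(A)` with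
  `α† = α`, and the involution defined by `D′` (if also ample) is `β ↦ α⁻¹ β† α`" (`α = nsToEnd Φ G₀ η₁`).

## References

* [Milne1999LefschetzClasses] J. S. Milne, *Lefschetz classes on abelian varieties*, Duke Math. J. 96
  (1999), 639–675, §1 (pp. 642–643).
* [Lange2023AbelianVarietiesComplex] H. Lange, *Abelian Varieties over the Complex Numbers*, Grundlehren
  Text Editions, Springer (2023), §2.4.1 Lemma 2.4.1, Prop. 2.4.2; §2.4.2 Prop. 2.4.12.
-/

noncomputable section

open scoped Real
open Set Function Complex Module Matrix

namespace Literature.Geometry.Kaehler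

namespace ComplexTorus

/-! ## §1 `C(A)` is stable under the Rosati involution of a polarisation -/

section Stable

variable {ι : Type*} [Fintype ι] [DecidableEq ι] {E : Type*} [NormedAddCommGroup E] [NormedSpace ℂ E]
  (Φ : (ι → ℝ) ≃L[ℝ] E)

omit [Fintype ι] [DecidableEq ι] in
/-- The realification of the Rosati involution on rational matrices is the Rosati involution of the
realified Gram matrix ("`f̂ := r ĥ`": `†` commutes with extension of scalars `ℚ → ℝ`).
[cite: Lange2023AbelianVarietiesComplex, §2.4.1 (definition of `f'` on `End_ℚ(X)`), p. 113] -/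
theorem map_ratCast_rosati [Fintype ι] [DecidableEq ι] {Gq : Matrix ι ι ℚ} {G : Matrix ι ι ℝ}
    (hGq : Gq.map (Rat.cast : ℚ → ℝ) = G) (hG : IsUnit G.det) (A : Matrix ι ι ℚ) :
    (rosati Gq A).map (Rat.cast : ℚ → ℝ) = rosati G (A.map (Rat.cast : ℚ → ℝ)) := by
  rw [show (rosati Gq A).map (Rat.cast : ℚ → ℝ) = (rosati Gq A).map (Rat.castHom ℝ) from rfl,
    rosati_map (Rat.castHom ℝ) (isUnit_det_of_map_ratCast hGq hG), Rat.coe_castHom, hGq]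

variable {Φ}

/-- **Milne 1999, §1: "`C(A)` is a `k`-algebra stable under the involution `†` defined by an ample
divisor `D`"** — at torus level, `k = ℝ`: for a polarisation `η` of `X` with Gram matrix `G`, the
centraliser `C(X)` of `End_ℚ(X)` in `M_ι(ℝ)` is stable under `M ↦ M† = G⁻¹ ᵗM G` (because `End_ℚ(X)` is
`†`-stable, Lemma 2.4.1, and `†` is an anti-involution). [cite: Milne1999LefschetzClasses, §1 (p. 642)]
[cite: Lange2023AbelianVarietiesComplex, §2.4.1 Lemma 2.4.1] -/
theorem IsRiemannForm.rosati_mem_endCentralizerAlg {η : E [⋀^Fin 2]→L[ℝ] ℝ} (hη : IsRiemannForm Φ η)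
    {M : Matrix ι ι ℝ} (hM : M ∈ endCentralizerAlg Φ) :
    rosati (latticeGram Φ η) M ∈ endCentralizerAlg Φ := by
  obtain ⟨Gq, hGq, -⟩ := hη.exists_ratMatrix_latticeGram_isUnit
  have hG : IsUnit (latticeGram Φ η).det := hη.isUnit_det_latticeGram
  have hGt : (latticeGram Φ η)ᵀ = -latticeGram Φ η := latticeGram_transpose Φ η
  rw [mem_endCentralizerAlg_iff] at hM ⊢
  intro A hA
  -- `A†` is an endomorphism, so `M` commutes with its realification `(A.map cast)†`
  have hc := hM _ (rosati_mem_endAlgRat Φ hη.1 hη.2.2 hGq hA)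
  rw [map_ratCast_rosati hGq hG] at hc
  -- apply `†`: `(M B)† = B† M†`, `(A†)† = A`
  have h := congrArg (rosati (latticeGram Φ η)) hc
  rw [rosati_mul hG, rosati_mul hG, rosati_rosati hG hGt] at h
  exact h.symm

/-- `†` is an involution on `M_ι(ℝ)` for the Gram matrix of a polarisation (`M†† = M`).
[cite: Lange2023AbelianVarietiesComplex, §2.4.1 Lemma 2.4.1] -/
theorem IsRiemannForm.rosati_rosati_latticeGram {η : E [⋀^Fin 2]→L[ℝ] ℝ} (hη : IsRiemannForm Φ η)
    (M : Matrix ι ι ℝ) : rosati (latticeGram Φ η) (rosati (latticeGram Φ η) M) = M :=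
  rosati_rosati hη.isUnit_det_latticeGram (latticeGram_transpose Φ η) M

/-- `†` is anti-multiplicative on `M_ι(ℝ)` for the Gram matrix of a polarisation (`(MN)† = N† M†`), so that
`(C(A), †)` is an algebra with involution. [cite: Milne1999LefschetzClasses, §1 (p. 642)]
[cite: Lange2023AbelianVarietiesComplex, §2.4.1 Lemma 2.4.1] -/
theorem IsRiemannForm.rosati_mul_latticeGram {η : E [⋀^Fin 2]→L[ℝ] ℝ} (hη : IsRiemannForm Φ η)
    (M N : Matrix ι ι ℝ) :
    rosati (latticeGram Φ η) (M * N) = rosati (latticeGram Φ η) N * rosati (latticeGram Φ η) M :=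
  rosati_mul hη.isUnit_det_latticeGram M N

end Stable

/-! ## §2 The restriction of `†` to `C(A)` is independent of the polarisation -/

section Independent

variable {ι : Type*} [Fintype ι] [DecidableEq ι] {E : Type*} [NormedAddCommGroup E] [NormedSpace ℂ E]
  {Φ : (ι → ℝ) ≃L[ℝ] E}

omit [Fintype ι] [DecidableEq ι] in
/-- Realification is multiplicative. [folklore] -/
private theorem map_ratCast_mul'' [Fintype ι] (A B : Matrix ι ι ℚ) :
    (A * B).map (Rat.cast : ℚ → ℝ) = A.map (Rat.cast : ℚ → ℝ) * B.map (Rat.cast : ℚ → ℝ) :=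
  Matrix.map_mul (f := Rat.castHom ℝ)

/-- **For `M ∈ C(A)` and a polarisation `E₀`, `M†_{E₁} = M†_{E₀}` for every NON-DEGENERATE `E₁ ∈ NS_ℚ(X)`**:
with `φ = φ_{E₀}⁻¹ φ_{E₁} ∈ End_ℚ(X)` (Prop. 2.4.12) one has `G₁ = G₀ φ`, and `M†₀ ∈ C(A)` commutes with
`φ`, so `ᵗM G₁ = G₀ M†₀ φ = G₁ M†₀`. [cite: Milne1999LefschetzClasses, §1 (p. 643: "independent of the choice of `D`")]
[cite: Lange2023AbelianVarietiesComplex, §2.4.2 Prop. 2.4.12] -/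
theorem IsRiemannForm.rosati_eq_of_mem_neronSeveriQ {η₀ η₁ : E [⋀^Fin 2]→L[ℝ] ℝ} (hη₀ : IsRiemannForm Φ η₀)
    (hη₁ : η₁ ∈ neronSeveriQ Φ) (hdet₁ : IsUnit (latticeGram Φ η₁).det) {M : Matrix ι ι ℝ}
    (hM : M ∈ endCentralizerAlg Φ) :
    rosati (latticeGram Φ η₁) M = rosati (latticeGram Φ η₀) M := by
  obtain ⟨G₀, hG₀, hdet₀⟩ := hη₀.exists_ratMatrix_latticeGram_isUnit
  have hG₀ℝ : IsUnit (latticeGram Φ η₀).det := hη₀.isUnit_det_latticeGram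
  -- `φ = G₀⁻¹ G₁ ∈ End_ℚ(X)` with `G₀ φ = G₁`
  set φ : Matrix ι ι ℚ := nsToEnd Φ G₀ ⟨η₁, hη₁⟩ with hφdef
  have hφ : φ ∈ endAlgRat Φ := (nsToEnd_mem_symmEndRat hη₀.1 hG₀ hdet₀ ⟨η₁, hη₁⟩).1
  have hGφ : G₀ * φ = ratGram Φ η₁ := (transpose_nsToEnd_mul hG₀ hdet₀ ⟨η₁, hη₁⟩).2
  have hG₁ : latticeGram Φ η₁ = latticeGram Φ η₀ * φ.map (Rat.cast : ℚ → ℝ) := by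
    rw [← hG₀, ← map_ratCast_mul'', hGφ, map_ratGram Φ hη₁]
  -- `M†₀ ∈ C(A)` commutes with `φ`
  have hcomm := (mem_endCentralizerAlg_iff Φ).1 (hη₀.rosati_mem_endCentralizerAlg hM) φ hφ
  rw [rosati_eq_iff hdet₁, hG₁]
  calc Mᵀ * (latticeGram Φ η₀ * φ.map (Rat.cast : ℚ → ℝ))
      = latticeGram Φ η₀ * rosati (latticeGram Φ η₀) M * φ.map (Rat.cast : ℚ → ℝ) := by
        rw [mul_rosati hG₀ℝ, Matrix.mul_assoc]
    _ = latticeGram Φ η₀ * φ.map (Rat.cast : ℚ → ℝ) * rosati (latticeGram Φ η₀) M := by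
        rw [Matrix.mul_assoc, hcomm, ← Matrix.mul_assoc]

/-- **Milne 1999, §1: "the restriction of `†` to `C(A)` is independent of the choice of `D`"** — at torus
level: two polarisations `η₀`, `η₁` of `X` induce the same involution on the centraliser `C(X)` of
`End_ℚ(X)` in `M_ι(ℝ)`. [cite: Milne1999LefschetzClasses, §1 (p. 643)] -/
theorem IsRiemannForm.rosati_eq_of_mem_endCentralizerAlg {η₀ η₁ : E [⋀^Fin 2]→L[ℝ] ℝ}
    (hη₀ : IsRiemannForm Φ η₀) (hη₁ : IsRiemannForm Φ η₁) {M : Matrix ι ι ℝ} (hM : M ∈ endCentralizerAlg Φ) :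
    rosati (latticeGram Φ η₁) M = rosati (latticeGram Φ η₀) M :=
  hη₀.rosati_eq_of_mem_neronSeveriQ (mem_neronSeveriQ_of_isRiemannForm Φ hη₁) hη₁.isUnit_det_latticeGram hM

omit [Fintype ι] [DecidableEq ι] in
/-- **`†_{Gα} = α⁻¹ (†_G ·) α`**: the adjoint involution of the form with Gram matrix `G α` is the `α`-conjugate of
that of `G` — `(Gα)⁻¹ ᵗβ (Gα) = α⁻¹ (G⁻¹ ᵗβ G) α` (Milne: "the involution defined by `D′` […] is `β ↦ α⁻¹ β† α`").
[cite: Milne1999LefschetzClasses, §1 (p. 642)] -/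
theorem rosati_mul_right_eq_conj [Fintype ι] [DecidableEq ι] {R : Type*} [CommRing R] (G α β : Matrix ι ι R) :
    rosati (G * α) β = α⁻¹ * rosati G β * α := by
  rw [rosati_def, rosati_def, Matrix.mul_inv_rev]
  simp only [Matrix.mul_assoc]

/-- **Milne 1999, §1: "If `D′` is a second divisor on `A`, then `e_{D′} = e_D ∘ (α × 1)` for some `α ∈ End⁰(A)`
with `α† = α` (Mumford 1970, p208), and the involution defined by `D′` (if also ample) is `β ↦ α⁻¹ β† α`"** — at
torus level, for a polarisation `η₀` with rational Gram matrix `G₀` and ANY non-degenerate `η₁ ∈ NS_ℚ(X)`: with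
`α = φ_{η₀}⁻¹ φ_{η₁} = nsToEnd Φ G₀ η₁ ∈ End_ℚ(X)` (Lange Prop. 2.4.12; `G₁ = G₀ α`, and `α†₀ = α` by
`nsToEnd_mem_symmEndRat`), `β†₁ = α⁻¹ β†₀ α` for EVERY real matrix `β` (on `C(A)` the two agree,
`rosati_eq_of_mem_neronSeveriQ`). [cite: Milne1999LefschetzClasses, §1 (p. 642)]
[cite: Lange2023AbelianVarietiesComplex, §2.4.2 Prop. 2.4.12, §5.1 (Rosati involution)] -/
theorem IsRiemannForm.rosati_latticeGram_eq_conj_nsToEnd {η₀ η₁ : E [⋀^Fin 2]→L[ℝ] ℝ} (hη₀ : IsRiemannForm Φ η₀)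
    {G₀ : Matrix ι ι ℚ} (hG₀ : G₀.map (Rat.cast : ℚ → ℝ) = latticeGram Φ η₀) (hη₁ : η₁ ∈ neronSeveriQ Φ)
    (β : Matrix ι ι ℝ) :
    rosati (latticeGram Φ η₁) β =
      ((nsToEnd Φ G₀ ⟨η₁, hη₁⟩).map (Rat.cast : ℚ → ℝ))⁻¹ * rosati (latticeGram Φ η₀) β *
        (nsToEnd Φ G₀ ⟨η₁, hη₁⟩).map (Rat.cast : ℚ → ℝ) := by
  have hdet₀ : IsUnit G₀.det := by
    have h := hη₀.isUnit_det_latticeGram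
    have e : (G₀.map (Rat.cast : ℚ → ℝ)).det = (G₀.det : ℝ) := by
      have h' := RingHom.map_det (Rat.castHom ℝ) G₀
      rw [RingHom.mapMatrix_apply, Rat.coe_castHom] at h'
      exact h'.symm
    rw [← hG₀, e, isUnit_iff_ne_zero, Rat.cast_ne_zero] at h
    exact isUnit_iff_ne_zero.2 h
  have hGφ : G₀ * nsToEnd Φ G₀ ⟨η₁, hη₁⟩ = ratGram Φ η₁ := (transpose_nsToEnd_mul hG₀ hdet₀ ⟨η₁, hη₁⟩).2
  have hG₁ : latticeGram Φ η₁ = latticeGram Φ η₀ * (nsToEnd Φ G₀ ⟨η₁, hη₁⟩).map (Rat.cast : ℚ → ℝ) := by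
    rw [← hG₀, ← map_ratCast_mul'', hGφ, map_ratGram Φ hη₁]
  rw [hG₁, rosati_mul_right_eq_conj]

end Independent

/-! ## §3 Products: the involution of `D = D₁ × A₂ + A₁ × D₂` is the product involution -/

section Prod

variable {ι₁ ι₂ : Type*} [Fintype ι₁] [Fintype ι₂] [DecidableEq ι₁] [DecidableEq ι₂]
  {E₁ E₂ : Type*} [NormedAddCommGroup E₁] [NormedSpace ℂ E₁] [NormedAddCommGroup E₂] [NormedSpace ℂ E₂]
  (Φ₁ : (ι₁ → ℝ) ≃L[ℝ] E₁) (Φ₂ : (ι₂ → ℝ) ≃L[ℝ] E₂)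

/-- The Gram matrix of the product form `E₁ ⊞ E₂` is non-degenerate when those of `E₁`, `E₂` are.
[cite: Milne1999LefschetzClasses, §1 (p. 643: "`D` is an ample divisor on `A`")] -/
theorem isUnit_det_latticeGram_prod {ω₁ : E₁ [⋀^Fin 2]→L[ℝ] ℝ} {ω₂ : E₂ [⋀^Fin 2]→L[ℝ] ℝ}
    (h₁ : IsUnit (latticeGram Φ₁ ω₁).det) (h₂ : IsUnit (latticeGram Φ₂ ω₂).det) :
    IsUnit (latticeGram (prodPeriod Φ₁ Φ₂) (prodForm ω₁ ω₂)).det := by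
  rw [latticeGram_prod, Matrix.det_fromBlocks_zero₂₁]
  exact h₁.mul h₂

/-- **Milne 1999, §1: for `A = A₁ × A₂` and ample `D_i` on `A_i`, "the involution [`D = D₁ × A₂ + A₁ × D₂`]
defines on `C(A)` is the restriction of the product of the involutions on the `C(A_i)` defined by the
`D_i`"** — at torus level: for the product form `E₁ ⊞ E₂` (block-diagonal Gram matrix) and block-diagonal
`(A 0; 0 D)`, `(A 0; 0 D)† = (A†₁ 0; 0 D†₂)`. [cite: Milne1999LefschetzClasses, §1 (p. 643)] -/
theorem rosati_latticeGram_prod_blockDiagAlg {ω₁ : E₁ [⋀^Fin 2]→L[ℝ] ℝ} {ω₂ : E₂ [⋀^Fin 2]→L[ℝ] ℝ}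
    (h₁ : IsUnit (latticeGram Φ₁ ω₁).det) (h₂ : IsUnit (latticeGram Φ₂ ω₂).det)
    (AD : Matrix ι₁ ι₁ ℝ × Matrix ι₂ ι₂ ℝ) :
    rosati (latticeGram (prodPeriod Φ₁ Φ₂) (prodForm ω₁ ω₂)) (blockDiagAlg ι₁ ι₂ AD) =
      blockDiagAlg ι₁ ι₂ (rosati (latticeGram Φ₁ ω₁) AD.1, rosati (latticeGram Φ₂ ω₂) AD.2) := by
  rw [rosati_eq_iff (isUnit_det_latticeGram_prod Φ₁ Φ₂ h₁ h₂), blockDiagAlg_apply, blockDiagAlg_apply,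
    latticeGram_prod, Matrix.fromBlocks_transpose, Matrix.fromBlocks_multiply, Matrix.fromBlocks_multiply]
  simp only [Matrix.transpose_zero, Matrix.mul_zero, Matrix.zero_mul, add_zero, zero_add]
  rw [mul_rosati h₁, mul_rosati h₂]

/-- The same for two polarisations `ω₁`, `ω₂` (Riemann forms). [cite: Milne1999LefschetzClasses, §1 (p. 643)] -/
theorem IsRiemannForm.rosati_latticeGram_prod_blockDiagAlg {ω₁ : E₁ [⋀^Fin 2]→L[ℝ] ℝ}
    {ω₂ : E₂ [⋀^Fin 2]→L[ℝ] ℝ} (h₁ : IsRiemannForm Φ₁ ω₁) (h₂ : IsRiemannForm Φ₂ ω₂)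
    (AD : Matrix ι₁ ι₁ ℝ × Matrix ι₂ ι₂ ℝ) :
    rosati (latticeGram (prodPeriod Φ₁ Φ₂) (prodForm ω₁ ω₂)) (blockDiagAlg ι₁ ι₂ AD) =
      blockDiagAlg ι₁ ι₂ (rosati (latticeGram Φ₁ ω₁) AD.1, rosati (latticeGram Φ₂ ω₂) AD.2) :=
  ComplexTorus.rosati_latticeGram_prod_blockDiagAlg Φ₁ Φ₂ h₁.isUnit_det_latticeGram
    h₂.isUnit_det_latticeGram AD

end Prod

/-! ## §4 Powers: `C(A) ≅ C(A^r)` as algebras with involution -/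

section Pow

variable {ι : Type*} [Fintype ι] [DecidableEq ι] {E : Type*} [NormedAddCommGroup E] [NormedSpace ℂ E]
  (Φ : (ι → ℝ) ≃L[ℝ] E) (n : ℕ)

/-- The Gram matrix of the power form `⊞ⁿ E` is non-degenerate when that of `E` is (`det = (det G)ⁿ`).
[cite: Milne1999LefschetzClasses, §1 (p. 643)] -/
theorem isUnit_det_latticeGram_pow {ω : E [⋀^Fin 2]→L[ℝ] ℝ} (h : IsUnit (latticeGram Φ ω).det) :
    IsUnit (latticeGram (powPeriod Φ n) (powForm ω n)).det := by
  rw [latticeGram_pow_eq_diagPow, det_diagPow]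
  exact h.pow n

/-- **Milne 1999, §1: "the diagonal action of `C(A)` on `rV(A)` identifies `C(A)` with `C(A^r)` (as
`k`-algebras with involution)"** — the involution part, at torus level: for the power form `⊞ⁿ E`
(Gram matrix `1ₙ ⊗ G`), `(Δₙ A)† = Δₙ (A†)`. [cite: Milne1999LefschetzClasses, §1 (p. 643)] -/
theorem rosati_latticeGram_pow_diagPow {ω : E [⋀^Fin 2]→L[ℝ] ℝ} (h : IsUnit (latticeGram Φ ω).det)
    (A : Matrix ι ι ℝ) :
    rosati (latticeGram (powPeriod Φ n) (powForm ω n)) (diagPow ι n A) =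
      diagPow ι n (rosati (latticeGram Φ ω) A) := by
  rw [rosati_eq_iff (isUnit_det_latticeGram_pow Φ n h), latticeGram_pow_eq_diagPow, transpose_diagPow,
    ← map_mul, ← map_mul, mul_rosati h]

/-- The same for a polarisation `ω` (Riemann form). [cite: Milne1999LefschetzClasses, §1 (p. 643)] -/
theorem IsRiemannForm.rosati_latticeGram_pow_diagPow {ω : E [⋀^Fin 2]→L[ℝ] ℝ} (hω : IsRiemannForm Φ ω)
    (n : ℕ) (A : Matrix ι ι ℝ) :
    rosati (latticeGram (powPeriod Φ n) (powForm ω n)) (diagPow ι n A) =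
      diagPow ι n (rosati (latticeGram Φ ω) A) :=
  ComplexTorus.rosati_latticeGram_pow_diagPow Φ n hω.isUnit_det_latticeGram A

end Pow

end ComplexTorus

end Literature.Geometry.Kaehler
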